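import Summits.NavierStokesRegularity.OSWSelfSimilar.SheetRWeakProfilePV
import Mathlib.Analysis.Calculus.ParametricIntegral
import Mathlib.Analysis.Calculus.Deriv.Shift
import Mathlib.MeasureTheory.Integral.Prod
import HarnessLib

/-!
# SHEET-ℝ: `(HΩ)′ = H[Ω′]` for `Ω ∈ C²` with `Ω, Ω′ ∈ L¹` — no pointwise decay hypothesis

HONEST FRAMING (cell ns-blowup GROUP B / zone Z3, case Z3-SR-SPEC item (P6b), the regularity input «Ω* ∈ C³»; 1-D MODEL
calculus on the tree's p.v. Hilbert transform `Literature.Analysis.Fourier.hilbertTransform`; not Euler, not NS).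

The tree's derivative lemmas for the line Hilbert transform (`Literature.Analysis.Fourier.hasDerivAt_hilbertTransform`,
`Literature.Analysis.Fourier.hasDerivAt_hilbertTransform_of_integrableOn`) assume the pointwise decay `|f′(y)| ≤ C/(1+y²)` and
`|f″| ≤ M` (one dominated-convergence argument on `(0, ∞)`). The energy class of the sheet-ℝ certificate does not supply such
decay before the weighted gain of `SheetRWeightedGain` — which itself needs one more derivative. This file removes the decay
hypothesis: for `f ∈ C²(ℝ)` with `f ∈ L¹` and `f′ ∈ L¹`,

  `HasDerivAt (hilbertTransform f) (hilbertTransform (deriv f) x) x`   at every `x`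
(`Summit.NavierStokesRegularity.OSWSelfSimilar.SheetRHilbertDerivL1.hasDerivAt_hilbertTransform_of_integrable_deriv`),

hence `hilbertTransform f ∈ C¹` (`…contDiff_one_hilbertTransform`). PROOF: split `Hf = π⁻¹(N + F)` at `t = 1`
(`SheetRWeakProfilePV` near/far pieces). NEAR piece `N(x) = ∫_{(0,1]} (f(x−t) − f(x+t))/t dt`: differentiation under the
integral with the LOCAL bound `2·sup_{[x₀−3, x₀+3]} |f″|` (mean value theorem). FAR piece `F(x) = ∫_{t>1} (f(x−t) − f(x+t))/t dt`:
NOT by domination (a window-sup of `|f′|` need not be integrable) but by Fubini + the fundamental theorem of calculus: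
`F(b) − F(a) = ∫_a^b D`, `D(y) = ∫_{t>1} (f′(y−t) − f′(y+t))/t dt` (the integrand on `[a,b] × (1,∞)` is dominated by
`|f′(y−t)| + |f′(y+t)|`, integrable by translation invariance), and `D` is continuous by the substituted far pieces of
`SheetRWeakProfilePV` applied to `f′ ∈ C⁰ ∩ L¹`. USE: with `Ω* ∈ C²`, `Ω*, Ω*′ ∈ L¹` (the tree's bootstrap + the energy class)
`HΩ* ∈ C¹`, so the strong equation `νΩ*″ = Ω* + ½ξΩ*′ + a𝒰Ω*′ − HΩ*·Ω*` gives `Ω* ∈ C³` — the regularity input of (P6b).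
[cite: King2009HilbertTransforms2, Appendix 1, Table 1.1, entry (1.20)] for the formula; MODEL-support calculus, not NS.
-/

noncomputable section

namespace Summit.NavierStokesRegularity.OSWSelfSimilar
namespace SheetRHilbertDerivL1

open _root_.MeasureTheory _root_.Set _root_.Filter Literature.Analysis.Fourier intervalIntegral
open scoped Real Topology

variable {f : ℝ → ℝ}

/-! ### The near piece: differentiation under the integral with a local `C²` bound -/

/-- Local mean-value bound for the DERIVATIVE integrand: if `|g′| ≤ M` on `[x₀ − 2, x₀ + 2]`, then for `|x − x₀| < 1` and
`t ∈ (0, 1]`, `|g(x − t) − g(x + t)|/t ≤ 2M` (applied below with `g = f′`). [folklore] -/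
theorem abs_symm_div_le {g : ℝ → ℝ} (hg : Differentiable ℝ g) {x₀ M : ℝ}
    (hM : ∀ y ∈ Icc (x₀ - 2) (x₀ + 2), |deriv g y| ≤ M) {x t : ℝ} (hx : x ∈ Metric.ball x₀ 1)
    (ht : t ∈ Ioc (0 : ℝ) 1) : |(g (x - t) - g (x + t)) / t| ≤ 2 * M := by
  have ht0 : 0 < t := ht.1
  have hx' : |x - x₀| < 1 := by rwa [Metric.mem_ball, Real.dist_eq] at hx
  have hxl : x₀ - 1 < x ∧ x < x₀ + 1 := by constructor <;> linarith [(abs_lt.1 hx').1, (abs_lt.1 hx').2]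
  have hsub : Icc (x - t) (x + t) ⊆ Icc (x₀ - 2) (x₀ + 2) := by
    intro y hy; exact ⟨by linarith [hy.1, ht.2], by linarith [hy.2, ht.2]⟩
  have hmvt : ‖g (x + t) - g (x - t)‖ ≤ M * ‖(x + t) - (x - t)‖ :=
    (convex_Icc (x - t) (x + t)).norm_image_sub_le_of_norm_deriv_le (fun y _ => hg.differentiableAt)
      (fun y hy => by rw [Real.norm_eq_abs]; exact hM y (hsub hy))
      (left_mem_Icc.2 (by linarith)) (right_mem_Icc.2 (by linarith))
  rw [Real.norm_eq_abs, Real.norm_eq_abs, show x + t - (x - t) = 2 * t by ring,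
    abs_of_pos (by linarith : (0:ℝ) < 2 * t)] at hmvt
  rw [abs_div, abs_of_pos ht0, div_le_iff₀ ht0, abs_sub_comm]
  linarith

/-- Measurability of the symmetric integrand `t ↦ (g(x−t) − g(x+t))/t` for continuous `g`. [folklore] -/
theorem measurable_symmIntegrand {g : ℝ → ℝ} (hg : Continuous g) (x : ℝ) :
    Measurable fun t : ℝ => (g (x - t) - g (x + t)) / t :=
  ((hg.comp (continuous_const.sub continuous_id)).sub (hg.comp (continuous_const.add continuous_id))).measurable.div
    measurable_id

/-- Pointwise `x`-derivative of the symmetric integrand. [folklore] -/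
theorem hasDerivAt_symmIntegrand (hf : Differentiable ℝ f) (t x : ℝ) :
    HasDerivAt (fun x => (f (x - t) - f (x + t)) / t) ((deriv f (x - t) - deriv f (x + t)) / t) x := by
  have h1 : HasDerivAt (fun x => f (x - t)) (deriv f (x - t)) x :=
    HasDerivAt.comp_sub_const x t (hf (x - t)).hasDerivAt
  have h2 : HasDerivAt (fun x => f (x + t)) (deriv f (x + t)) x :=
    HasDerivAt.comp_add_const x t (hf (x + t)).hasDerivAt
  exact (h1.sub h2).div_const t

/-- **Derivative of the near piece.** For `f ∈ C²` with `f ∈ L¹`: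
`d/dx ∫_{(0,1]} (f(x−t) − f(x+t))/t dt = ∫_{(0,1]} (f′(x−t) − f′(x+t))/t dt`. [folklore] -/
theorem hasDerivAt_nearPiece (hf : ContDiff ℝ 2 f) (hfi : Integrable f) (x₀ : ℝ) :
    HasDerivAt (fun x => ∫ t in Ioc (0 : ℝ) 1, (f (x - t) - f (x + t)) / t)
      (∫ t in Ioc (0 : ℝ) 1, (deriv f (x₀ - t) - deriv f (x₀ + t)) / t) x₀ := by
  have hc : Continuous f := hf.continuous
  have hd : Differentiable ℝ f := hf.differentiable (by norm_num)
  have h1 : ContDiff ℝ 1 (deriv f) := (contDiff_succ_iff_deriv.1 (hf : ContDiff ℝ (1 + 1) f)).2.2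
  have hc' : Continuous (deriv f) := h1.continuous
  have hd' : Differentiable ℝ (deriv f) := h1.differentiable (by norm_num)
  have hc'' : Continuous (deriv (deriv f)) := h1.continuous_deriv le_rfl
  obtain ⟨M, hM⟩ := isCompact_Icc.exists_bound_of_continuousOn
    (hc''.continuousOn (s := Icc (x₀ - 2) (x₀ + 2)))
  have hM' : ∀ y ∈ Icc (x₀ - 2) (x₀ + 2), |deriv (deriv f) y| ≤ M := fun y hy => by
    rw [← Real.norm_eq_abs]; exact hM y hy
  have hint : IntegrableOn (fun t => (f (x₀ - t) - f (x₀ + t)) / t) (Ioc 0 1) :=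
    (integrableOn_symmIntegrand_of_contDiff (hf.of_le (by norm_num)) hfi x₀).mono_set Ioc_subset_Ioi_self
  have key := hasDerivAt_integral_of_dominated_loc_of_deriv_le (μ := volume.restrict (Ioc (0:ℝ) 1))
    (F := fun x t => (f (x - t) - f (x + t)) / t) (F' := fun x t => (deriv f (x - t) - deriv f (x + t)) / t)
    (x₀ := x₀) (bound := fun _ => 2 * M) (Metric.ball_mem_nhds x₀ one_pos)
    (Eventually.of_forall fun x => (measurable_symmIntegrand hc x).aestronglyMeasurable) hint
    (measurable_symmIntegrand hc' x₀).aestronglyMeasurable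
    (ae_restrict_of_forall_mem measurableSet_Ioc fun t ht x hx => by
      rw [Real.norm_eq_abs]; exact abs_symm_div_le hd' hM' hx ht)
    (integrableOn_const (by simp))
    (Eventually.of_forall fun t x _ => hasDerivAt_symmIntegrand hd t x)
  exact key.2

/-! ### The far piece: Fubini + fundamental theorem of calculus -/

/-- For `g ∈ C⁰ ∩ L¹`, the far integrand `t ↦ (g(x−t) − g(x+t))/t` is integrable on `(1, ∞)`. [folklore] -/
theorem integrableOn_far_symm {g : ℝ → ℝ} (hg : Continuous g) (hgi : Integrable g) (x : ℝ) :
    IntegrableOn (fun t => (g (x - t) - g (x + t)) / t) (Ioi (1 : ℝ)) := by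
  obtain ⟨hL, hR⟩ := SheetRWeakProfilePV.integrableOn_farPieces hg hgi x
  refine (hL.sub hR).congr_fun (fun t _ => ?_) measurableSet_Ioi
  simp only [Pi.sub_apply]; ring

/-- The far integrand is dominated by `|g(x−t)| + |g(x+t)|` on `t > 1`, whose `t`-integral is at most `2‖g‖₁`. [folklore] -/
theorem integral_abs_far_symm_le {g : ℝ → ℝ} (hg : Continuous g) (hgi : Integrable g) (x : ℝ) :
    ∫ t in Ioi (1 : ℝ), ‖(g (x - t) - g (x + t)) / t‖ ≤ 2 * ∫ y, |g y| := by
  have hA : Integrable fun t => g (x - t) := hgi.comp_sub_left x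
  have hB : Integrable fun t => g (x + t) := hgi.comp_add_left x
  have hdom : IntegrableOn (fun t => |g (x - t)| + |g (x + t)|) (Ioi (1:ℝ)) := (hA.abs.add hB.abs).integrableOn
  calc ∫ t in Ioi (1 : ℝ), ‖(g (x - t) - g (x + t)) / t‖
      ≤ ∫ t in Ioi (1 : ℝ), (|g (x - t)| + |g (x + t)|) := by
        refine setIntegral_mono_on (integrableOn_far_symm hg hgi x).norm hdom measurableSet_Ioi fun t ht => ?_
        have ht1 : 1 < t := ht
        rw [Real.norm_eq_abs, abs_div, abs_of_pos (by linarith : (0:ℝ) < t), div_le_iff₀ (by linarith : (0:ℝ) < t)]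
        calc |g (x - t) - g (x + t)| ≤ |g (x - t)| + |g (x + t)| := abs_sub _ _
          _ ≤ (|g (x - t)| + |g (x + t)|) * t := le_mul_of_one_le_right (by positivity) ht1.le
    _ ≤ ∫ t, (|g (x - t)| + |g (x + t)|) :=
        setIntegral_le_integral (hA.abs.add hB.abs) (Eventually.of_forall fun t => by positivity)
    _ = 2 * ∫ y, |g y| := by
        rw [integral_add hA.abs hB.abs]
        have e1 : ∫ t, |g (x - t)| = ∫ y, |g y| := integral_sub_left_eq_self (fun y => |g y|) volume x
        have e2 : ∫ t, |g (x + t)| = ∫ y, |g y| := integral_add_left_eq_self (fun y => |g y|) x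
        rw [e1, e2]; ring

/-- **Fubini step.** For `f ∈ C¹` with `f′ ∈ C⁰ ∩ L¹` (and `f ∈ L¹`), with `F(x) = ∫_{t>1}(f(x−t) − f(x+t))/t dt` and
`D(y) = ∫_{t>1}(f′(y−t) − f′(y+t))/t dt`: `F(b) − F(a) = ∫_a^b D`. [folklore] -/
theorem far_sub_far_eq_integral (hf : ContDiff ℝ 1 f) (hfi : Integrable f) (hf'i : Integrable (deriv f))
    (a b : ℝ) :
    (∫ t in Ioi (1 : ℝ), (f (b - t) - f (b + t)) / t) - (∫ t in Ioi (1 : ℝ), (f (a - t) - f (a + t)) / t) =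
      ∫ y in a..b, ∫ t in Ioi (1 : ℝ), (deriv f (y - t) - deriv f (y + t)) / t := by
  have hc : Continuous f := hf.continuous
  have hd : Differentiable ℝ f := hf.differentiable (by norm_num)
  have hc' : Continuous (deriv f) := hf.continuous_deriv le_rfl
  have hderiv : ∀ y, HasDerivAt f (deriv f y) y := fun y => (hd y).hasDerivAt
  -- joint integrability on `uIoc a b × (1, ∞)`
  set G : ℝ → ℝ → ℝ := fun y t => (deriv f (y - t) - deriv f (y + t)) / t with hG
  have hGm : Measurable (Function.uncurry G) := by
    have h1 : Measurable fun p : ℝ × ℝ => deriv f (p.1 - p.2) := hc'.measurable.comp measurable_sub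
    have h2 : Measurable fun p : ℝ × ℝ => deriv f (p.1 + p.2) := hc'.measurable.comp measurable_add
    exact (h1.sub h2).div measurable_snd
  have hGint : Integrable (Function.uncurry G) ((volume.restrict (uIoc a b)).prod (volume.restrict (Ioi (1:ℝ)))) := by
    rw [integrable_prod_iff hGm.aestronglyMeasurable]
    refine ⟨Eventually.of_forall fun y => integrableOn_far_symm hc' hf'i y, ?_⟩
    refine Integrable.mono' (g := fun _ => 2 * ∫ y, |deriv f y|) (integrableOn_const (by
        simp [Real.volume_uIoc])) (hGm.aestronglyMeasurable.norm.integral_prod_right') ?_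
    refine Eventually.of_forall fun y => ?_
    rw [Real.norm_eq_abs, abs_of_nonneg (integral_nonneg fun t => norm_nonneg _)]
    exact integral_abs_far_symm_le hc' hf'i y
  -- Fubini
  have hswap := intervalIntegral_integral_swap (μ := volume.restrict (Ioi (1:ℝ))) hGint
  simp only [hG] at hswap
  rw [hswap]
  -- the inner interval integrals by FTC
  have hinner : ∀ t : ℝ, ∫ y in a..b, (deriv f (y - t) - deriv f (y + t)) / t =
      ((f (b - t) - f (b + t)) - (f (a - t) - f (a + t))) / t := by
    intro t
    have i1 : ∫ y in a..b, deriv f (y - t) = f (b - t) - f (a - t) := by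
      rw [intervalIntegral.integral_comp_sub_right (fun y => deriv f y) t]
      exact integral_eq_sub_of_hasDerivAt (fun y _ => hderiv y)
        ((hc'.intervalIntegrable _ _))
    have i2 : ∫ y in a..b, deriv f (y + t) = f (b + t) - f (a + t) := by
      rw [intervalIntegral.integral_comp_add_right (fun y => deriv f y) t]
      exact integral_eq_sub_of_hasDerivAt (fun y _ => hderiv y)
        ((hc'.intervalIntegrable _ _))
    have j1 : IntervalIntegrable (fun y => deriv f (y - t)) volume a b :=
      (hc'.comp (continuous_id.sub continuous_const)).intervalIntegrable _ _
    have j2 : IntervalIntegrable (fun y => deriv f (y + t)) volume a b :=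
      (hc'.comp (continuous_id.add continuous_const)).intervalIntegrable _ _
    rw [intervalIntegral.integral_div, intervalIntegral.integral_sub j1 j2, i1, i2]
    ring
  simp_rw [hinner]
  rw [← integral_sub (integrableOn_far_symm hc hfi b) (integrableOn_far_symm hc hfi a)]
  refine setIntegral_congr_fun measurableSet_Ioi fun t _ => ?_
  ring

/-- The far derivative piece `D(y) = ∫_{t>1}(f′(y−t) − f′(y+t))/t dt` is continuous (substituted far pieces of
`SheetRWeakProfilePV`, dominated by `|f′|`). [folklore] -/
theorem continuous_far_deriv {g : ℝ → ℝ} (hg : Continuous g) (hgi : Integrable g) :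
    Continuous fun y => ∫ t in Ioi (1 : ℝ), (g (y - t) - g (y + t)) / t := by
  have h : (fun y => ∫ t in Ioi (1 : ℝ), (g (y - t) - g (y + t)) / t) = fun y =>
      (∫ s, (Iio (y - 1)).indicator (fun s => g s / (y - s)) s)
        - ∫ s, (Ioi (y + 1)).indicator (fun s => g s / (s - y)) s := by
    funext y
    obtain ⟨hL, hR⟩ := SheetRWeakProfilePV.integrableOn_farPieces hg hgi y
    rw [← SheetRWeakProfilePV.farPiece_left_eq, ← SheetRWeakProfilePV.farPiece_right_eq, ← integral_sub hL hR]
    refine setIntegral_congr_fun measurableSet_Ioi fun t _ => ?_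
    ring
  rw [h]
  exact (SheetRWeakProfilePV.continuous_farPiece_left hg hgi).sub
    (SheetRWeakProfilePV.continuous_farPiece_right hg hgi)

/-- **Derivative of the far piece.** For `f ∈ C¹ ∩ L¹` with `f′ ∈ L¹`:
`d/dx ∫_{t>1} (f(x−t) − f(x+t))/t dt = ∫_{t>1} (f′(x−t) − f′(x+t))/t dt` at every `x`. [folklore] -/
theorem hasDerivAt_farPiece (hf : ContDiff ℝ 1 f) (hfi : Integrable f) (hf'i : Integrable (deriv f)) (x₀ : ℝ) :
    HasDerivAt (fun x => ∫ t in Ioi (1 : ℝ), (f (x - t) - f (x + t)) / t)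
      (∫ t in Ioi (1 : ℝ), (deriv f (x₀ - t) - deriv f (x₀ + t)) / t) x₀ := by
  have hc' : Continuous (deriv f) := hf.continuous_deriv le_rfl
  have hD := continuous_far_deriv hc' hf'i
  have hFTC := (hD.integral_hasStrictDerivAt x₀ x₀).hasDerivAt
  have hconst := hFTC.const_add (∫ t in Ioi (1 : ℝ), (f (x₀ - t) - f (x₀ + t)) / t)
  refine hconst.congr_of_eventuallyEq (Eventually.of_forall fun x => ?_)
  have h := far_sub_far_eq_integral hf hfi hf'i x₀ x
  show (∫ t in Ioi (1 : ℝ), (f (x - t) - f (x + t)) / t) =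
    (∫ t in Ioi (1 : ℝ), (f (x₀ - t) - f (x₀ + t)) / t)
      + ∫ y in x₀..x, ∫ t in Ioi (1 : ℝ), (deriv f (y - t) - deriv f (y + t)) / t
  linarith

/-! ### Assembly -/

/-- The split `Hg(x) = π⁻¹ (∫_{(0,1]} + ∫_{(1,∞)})` of the symmetric p.v. integral, for `g ∈ C¹ ∩ L¹`. [folklore] -/
theorem hilbertTransform_eq_near_add_far' {g : ℝ → ℝ} (hg : ContDiff ℝ 1 g) (hgi : Integrable g) (x : ℝ) :
    hilbertTransform g x = π⁻¹ * ((∫ t in Ioc (0 : ℝ) 1, (g (x - t) - g (x + t)) / t)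
      + ∫ t in Ioi (1 : ℝ), (g (x - t) - g (x + t)) / t) := by
  have hint := integrableOn_symmIntegrand_of_contDiff hg hgi x
  have hsplit : Ioi (0 : ℝ) = Ioc 0 1 ∪ Ioi 1 := (Ioc_union_Ioi_eq_Ioi zero_le_one).symm
  rw [hilbertTransform, hsplit, setIntegral_union (Set.Ioc_disjoint_Ioi le_rfl) measurableSet_Ioi
    (hint.mono_set (by rw [hsplit]; exact subset_union_left))
    (hint.mono_set (by rw [hsplit]; exact subset_union_right))]

/-- **`(Hf)′ = H[f′]` without decay.** For `f ∈ C²(ℝ)` with `f ∈ L¹` and `f′ ∈ L¹`, the p.v. Hilbert transform is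
differentiable at every point with derivative the Hilbert transform of the derivative.
[cite: King2009HilbertTransforms2, Appendix 1, Table 1.1, entry (1.20)] -/
theorem hasDerivAt_hilbertTransform_of_integrable_deriv (hf : ContDiff ℝ 2 f) (hfi : Integrable f)
    (hf'i : Integrable (deriv f)) (x₀ : ℝ) :
    HasDerivAt (hilbertTransform f) (hilbertTransform (deriv f) x₀) x₀ := by
  have hf1 : ContDiff ℝ 1 f := hf.of_le (by norm_num)
  have h1 : ContDiff ℝ 1 (deriv f) := (contDiff_succ_iff_deriv.1 (hf : ContDiff ℝ (1 + 1) f)).2.2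
  have hN := hasDerivAt_nearPiece hf hfi x₀
  have hF := hasDerivAt_farPiece hf1 hfi hf'i x₀
  have hsum := (hN.add hF).const_mul π⁻¹
  have key : HasDerivAt (hilbertTransform f)
      (π⁻¹ * ((∫ t in Ioc (0 : ℝ) 1, (deriv f (x₀ - t) - deriv f (x₀ + t)) / t)
        + ∫ t in Ioi (1 : ℝ), (deriv f (x₀ - t) - deriv f (x₀ + t)) / t)) x₀ := by
    refine hsum.congr_of_eventuallyEq (Eventually.of_forall fun y => ?_)
    show hilbertTransform f y = π⁻¹ * (((fun x => ∫ t in Ioc (0 : ℝ) 1, (f (x - t) - f (x + t)) / t)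
      + fun x => ∫ t in Ioi (1 : ℝ), (f (x - t) - f (x + t)) / t) y)
    simp only [Pi.add_apply]
    exact hilbertTransform_eq_near_add_far' hf1 hfi y
  rw [hilbertTransform_eq_near_add_far' h1 hf'i x₀]
  exact key

/-- `deriv (Hf) = H(f′)` pointwise, under the same hypotheses. [cite: King2009HilbertTransforms2, Appendix 1, Table 1.1, entry (1.20)] -/
theorem deriv_hilbertTransform_of_integrable_deriv (hf : ContDiff ℝ 2 f) (hfi : Integrable f)
    (hf'i : Integrable (deriv f)) (x : ℝ) :
    deriv (hilbertTransform f) x = hilbertTransform (deriv f) x :=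
  (hasDerivAt_hilbertTransform_of_integrable_deriv hf hfi hf'i x).deriv

/-- **`Hf ∈ C¹`** for `f ∈ C²` with `f, f′ ∈ L¹` (the derivative `H[f′]` is continuous since `f′ ∈ C¹ ∩ L¹`,
`SheetRWeakProfilePV.continuous_hilbertTransform_of_contDiff`). [cite: King2009HilbertTransforms2, Appendix 1, Table 1.1, entry (1.20)] -/
theorem contDiff_one_hilbertTransform (hf : ContDiff ℝ 2 f) (hfi : Integrable f)
    (hf'i : Integrable (deriv f)) : ContDiff ℝ 1 (hilbertTransform f) := by
  have h1 : ContDiff ℝ 1 (deriv f) := (contDiff_succ_iff_deriv.1 (hf : ContDiff ℝ (1 + 1) f)).2.2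
  have hcont : Continuous (hilbertTransform (deriv f)) :=
    SheetRWeakProfilePV.continuous_hilbertTransform_of_contDiff h1 hf'i
  have hderiv : deriv (hilbertTransform f) = hilbertTransform (deriv f) :=
    funext fun x => deriv_hilbertTransform_of_integrable_deriv hf hfi hf'i x
  rw [contDiff_one_iff_deriv]
  exact ⟨fun x => (hasDerivAt_hilbertTransform_of_integrable_deriv hf hfi hf'i x).differentiableAt,
    by rw [hderiv]; exact hcont⟩

end SheetRHilbertDerivL1
end Summit.NavierStokesRegularity.OSWSelfSimilar

end
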